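/-
HONEST FRAMING: certified error envelopes and provably optimal rounding/accumulation schemes for
low-precision formats under stated cost models; every table by two implementations; no hardware
or vendor claims.
-/
import Summits.Ventures.CertifiedArithmetic.LowPrec.OptDemotionRootStep
import Summits.Ventures.CertifiedArithmetic.LowPrec.OptDemotionNodeWrapU

/-!
# The demotion law (Theorem T8), part 6d: Conjecture D for every tree WHOSE SUBTREES ARE GOOD-ACTIVE

OPTIMA.md §B T8(b)(iii) (Conjecture D): accumulate a summation tree of nonnegative `F_q` data in the
wide format (any nearest rounding), demote the root ONCE to `F_p` (any nearest rounding); then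
`s ≤ Q_t · fl_p(ŝ)` with opt's coupled tree polynomial `Q_t = treeQf u_q t u_p`, for EVERY tree.
Part 4 proved `D_t ≥ Q_t` for every tree; part 5f proved `D_t ≤ Q_t` for every tree with
`M_t(u_q) ≤ 2`, the cap entering only through the node step.

THIS FILE removes the cap on `M_t` in exchange for opt's GOOD-ACTIVE property (OPTIMA (iii″)(R9)(2))
ON THE SUBTREES of the given tree, q-uniformly:

* `deficit_allLine_bound` — THE LINE INVARIANT IN THE FULL FAMILY: for every tree `t` in a class `C`
  closed under taking children on which GOOD-ACTIVE holds, and nonnegative `F(q, emin)` data: if the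
  computed value `v > 0` then `s - v ≤ ufp(v)(α - λ) + λ v` for some line `(α, λ) ∈ L_t`
  (`allLines`).  Induction: the children's lines are made GOOD by GOOD-ACTIVE at the child's grid
  excess (`good_line_of_line`), the unfiltered node lemma for unbounded `μ` (`nodeU_covers`, parts
  6c–6c″) covers the node deficit by one of the eight transforms — all members of `L_{a·b}`.
* `exact_le_treeQf_mul_fl_of_goodActive` — with the root step of part 6b:
  **GOOD-ACTIVE on the class ⟹ `s ≤ Q_t · fl_p(ŝ)`**, all `p, q ≥ 1`, any nearest roundings, ANY
  tree polynomial; `conjectureD_of_goodActive` — the global form (`GoodActive q` of part 6a ⟹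
  Conjecture D for every tree at `q`).
* AN UNCONDITIONAL CLASS beyond `M_t ≤ 2`: `UBalanced u t` (at every node the children's tree
  polynomials differ by at most `u`; e.g. every PERFECT tree of ANY height, `uBalanced_of_isPerfect`)
  ⟹ every line of `L_t` is good (`allLines_good_of_uBalanced`) ⟹ GOOD-ACTIVE trivially ⟹
  `exact_le_treeQf_mul_fl_of_uBalanced`: Conjecture D for all u-balanced trees (pairwise summation of
  `2^h` terms for every `h`, where part 5f stopped at `(1+u_q)^h ≤ 2`).  With part 4's witness:
  `D_t = Q_t` EXACTLY on this class.

HONEST STATUS OF GOOD-ACTIVE (lean g9, part 6e `OptDemotionGoodActiveCex`): the GLOBAL statement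
`GoodActive q` is FALSE at `q = 5` — a 43-leaf tree whose envelope at the top grid excess `x = 15/16`
is attained only by a line with `λ - α = 63/16384 > 0` (kernel-checked; a 77-leaf tree fails at
`q = 4`, `x = 7/8`; opt's 73 280-point scan had found no exception).  So `conjectureD_of_goodActive`
is vacuous at such `q` and the CLASS form above is the theorem to use; the node step itself holds at
those trees (the envelope is far from tight at multi-bit excesses), i.e. GOOD-ACTIVE was a sufficient,
not a necessary, single-tree input.  What Conjecture D still needs in general is a node lemma whose
child interface tolerates a (slightly) bad active line — open.
-/

namespace Summit.Ventures.CertifiedArithmetic.LowPrec.Opt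

open Literature.ComputerArithmetic.JeannerodRump2018
open Literature.ComputerArithmetic.JeannerodRump2018.SumTree
open Demotion

/-! ## GOOD-ACTIVE per tree -/

/-- GOOD-ACTIVE for ONE tree at ONE excess `x`: every line of `L_t` is dominated at `x` by a good
line of `L_t`. -/
def GoodActiveAt (u : ℚ) (t : SumTree) (x : ℚ) : Prop :=
  ∀ l ∈ allLines u t, ∃ l' ∈ allLines u t, l'.2 ≤ l'.1 ∧ l.1 + l.2 * x ≤ l'.1 + l'.2 * x

/-- GOOD-ACTIVE for one tree at precision `q`: at every grid excess `x = 2k·u_q < 1`. -/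
def GoodActiveTree (q : ℕ) (t : SumTree) : Prop :=
  ∀ k : ℕ, (k : ℚ) * (2 * unitRoundoff q) < 1 →
    GoodActiveAt (unitRoundoff q) t ((k : ℚ) * (2 * unitRoundoff q))

/-- The global statement of part 6a is the per-tree statement for every tree. -/
theorem goodActive_iff (q : ℕ) : GoodActive q ↔ ∀ t : SumTree, GoodActiveTree q t := Iff.rfl

/-! ## Grid excess of a float and the upgrade of a line -/

/-- A positive float `v` of `F(q, emin)` reads `v = ufp(v)·(1 + k·2u_q)` with a GRID excess
`k·2u_q < 1`. -/
theorem exists_grid_excess {q : ℕ} (hq : 1 ≤ q) {emin : ℤ} {v : ℚ} (hv : IsFloat q emin v)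
    (hpos : 0 < v) :
    ∃ k : ℕ, v = (2 : ℚ) ^ (Int.log 2 v) * (1 + (k : ℚ) * (2 * unitRoundoff q)) ∧
      (k : ℚ) * (2 * unitRoundoff q) < 1 := by
  have h2 : (2 : ℚ) ≠ 0 := by norm_num
  set K := Int.log 2 v with hK
  have hvlo : ((2 : ℕ) : ℚ) ^ K ≤ v := Int.zpow_log_le_self (by norm_num) hpos
  have hvhi : v < ((2 : ℕ) : ℚ) ^ (K + 1) := Int.lt_zpow_succ_log_self (by norm_num) v
  push_cast at hvlo hvhi
  have hσpos : (0 : ℚ) < (2 : ℚ) ^ K := zpow_pos (by norm_num) _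
  obtain ⟨N, hN⟩ := isFloat_grid hv hvlo
  have hgpos : (0 : ℚ) < (2 : ℚ) ^ (K + 1 - q) := zpow_pos (by norm_num) _
  obtain ⟨-, hug2⟩ := u_mul_zpow q K
  obtain ⟨e, he⟩ : ∃ e : ℕ, (q : ℤ) = 1 + e := ⟨q - 1, by omega⟩
  have hσg : (2 : ℚ) ^ K = ((2 ^ e : ℤ) : ℚ) * (2 : ℚ) ^ (K + 1 - q) := by
    push_cast
    rw [← zpow_natCast, ← zpow_add₀ h2]; congr 1; omega
  -- N ≥ 2^e
  have hNge : ((2 ^ e : ℤ) : ℚ) ≤ (N : ℚ) := by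
    have h1 : ((2 ^ e : ℤ) : ℚ) * (2 : ℚ) ^ (K + 1 - q) ≤ (N : ℚ) * (2 : ℚ) ^ (K + 1 - q) := by
      rw [← hσg, ← hN]; exact hvlo
    exact le_of_mul_le_mul_right h1 hgpos
  have hNge' : (2 ^ e : ℤ) ≤ N := by exact_mod_cast hNge
  obtain ⟨k, hk⟩ : ∃ k : ℕ, N = 2 ^ e + (k : ℤ) := ⟨(N - 2 ^ e).toNat, by omega⟩
  -- v = N g = 2^K + k g = 2^K (1 + k·2u)
  have e1 : v = (2 : ℚ) ^ K + (k : ℚ) * (2 * unitRoundoff q * (2 : ℚ) ^ K) := by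
    rw [hug2, hσg, hN, hk]; push_cast; ring
  refine ⟨k, by rw [e1]; ring, ?_⟩
  -- from v < 2^(K+1)
  rw [zpow_add_one₀ h2] at hvhi
  by_contra hc
  have hc' : 1 ≤ (k : ℚ) * (2 * unitRoundoff q) := not_lt.mp hc
  have : (2 : ℚ) ^ K ≤ (k : ℚ) * (2 * unitRoundoff q) * (2 : ℚ) ^ K := by
    have := mul_le_mul_of_nonneg_right hc' hσpos.le; linarith
  nlinarith

/-- UPGRADE OF A LINE BY GOOD-ACTIVE: a deficit bound `d ≤ ufp(v)(α - λ) + λ v` by ANY line of `L_c`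
at a positive float `v` of `F(q, emin)` is also a bound by a GOOD line of `L_c`. -/
theorem good_line_of_line {q : ℕ} (hq : 1 ≤ q) {emin : ℤ} {c : SumTree} (hG : GoodActiveTree q c)
    {v d : ℚ} (hv : IsFloat q emin v) (hpos : 0 < v) {l : ℚ × ℚ}
    (hl : l ∈ allLines (unitRoundoff q) c)
    (hd : d ≤ (2 : ℚ) ^ (Int.log 2 v) * (l.1 - l.2) + l.2 * v) :
    ∃ l' ∈ allLines (unitRoundoff q) c, l'.2 ≤ l'.1 ∧
      d ≤ (2 : ℚ) ^ (Int.log 2 v) * (l'.1 - l'.2) + l'.2 * v := by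
  obtain ⟨k, hvk, hk1⟩ := exists_grid_excess hq hv hpos
  obtain ⟨l', hl', hgood, hdom⟩ := hG k hk1 l hl
  refine ⟨l', hl', hgood, ?_⟩
  have hσpos : (0 : ℚ) < (2 : ℚ) ^ (Int.log 2 v) := zpow_pos (by norm_num) _
  set σ := (2 : ℚ) ^ (Int.log 2 v) with hσ
  set x := (k : ℚ) * (2 * unitRoundoff q) with hx
  have e1 : σ * (l.1 - l.2) + l.2 * v = σ * (l.1 + l.2 * x) := by rw [hvk]; ring
  have e2 : σ * (l'.1 - l'.2) + l'.2 * v = σ * (l'.1 + l'.2 * x) := by rw [hvk]; ring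
  rw [e2]; rw [e1] at hd
  exact hd.trans (mul_le_mul_of_nonneg_left hdom hσpos.le)

/-! ## The line invariant in the full family -/

section Main

variable {q : ℕ} {emin : ℤ} {fl : ℚ → ℚ}

/-- THE LINE INVARIANT IN THE FULL FAMILY.  `C` is any class of trees closed under taking children
on which GOOD-ACTIVE holds (e.g. all trees under `GoodActive q`, or the u-balanced trees).  For every
`t ∈ C` with nonnegative `F(q, emin)` data: if the computed value vanishes so does the exact sum, and
if it is positive then `s - v ≤ ufp(v)(α - λ) + λ v` for some line `(α, λ)` of `L_t` — with NO
hypothesis on the tree polynomial `M_t`. -/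
theorem deficit_allLine_bound (hq : 1 ≤ q) (hfl : IsRoundNearest q emin fl)
    (C : SumTree → Prop) (hC : ∀ a b, C (.node a b) → C a ∧ C b)
    (hG : ∀ s, C s → GoodActiveTree q s) :
    ∀ t : SumTree, C t → (∀ x ∈ leaves t, IsFloat q emin x ∧ 0 ≤ x) →
      (eval fl t = 0 → exact t ≤ 0) ∧
      (0 < eval fl t → ∃ l ∈ allLines (unitRoundoff q) t,
        exact t - eval fl t ≤ (2 : ℚ) ^ (Int.log 2 (eval fl t)) * (l.1 - l.2) + l.2 * eval fl t)
  | .leaf x, _, h => by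
      refine ⟨fun h0 => by simpa [eval, exact] using h0.le, fun _ => ⟨(0, 0), by simp, ?_⟩⟩
      simp [eval, exact]
  | .node a b, hCt, h => by
      have hu0 := unitRoundoff_nonneg q
      have hu1 := unitRoundoff_le_one q
      obtain ⟨hCa, hCb⟩ := hC a b hCt
      have hla : ∀ x ∈ leaves a, IsFloat q emin x ∧ 0 ≤ x := fun x hx => h x (by simp [leaves, hx])
      have hlb : ∀ x ∈ leaves b, IsFloat q emin x ∧ 0 ≤ x := fun x hx => h x (by simp [leaves, hx])
      obtain ⟨iha0, iha⟩ := deficit_allLine_bound hq hfl C hC hG a hCa hla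
      obtain ⟨ihb0, ihb⟩ := deficit_allLine_bound hq hfl C hC hG b hCb hlb
      obtain ⟨haF, ha0⟩ := eval_isFloat_nonneg hfl a hla
      obtain ⟨hbF, hb0⟩ := eval_isFloat_nonneg hfl b hlb
      have hva_le : eval fl a ≤ eval fl (.node a b) :=
        le_fl_of_isFloat_le hfl haF (le_add_of_nonneg_right hb0)
      have hvb_le : eval fl b ≤ eval fl (.node a b) := by
        simp only [eval]
        exact le_fl_of_isFloat_le hfl hbF (le_add_of_nonneg_left ha0)
      refine ⟨fun h0 => ?_, fun hpos => ?_⟩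
      · have ha' : eval fl a = 0 := le_antisymm (h0 ▸ hva_le) ha0
        have hb' : eval fl b = 0 := le_antisymm (h0 ▸ hvb_le) hb0
        simp only [exact]; linarith [iha0 ha', ihb0 hb']
      · set v := eval fl (.node a b) with hv
        have hvdef : v = fl (eval fl a + eval fl b) := rfl
        set K := Int.log 2 v with hK
        have hvlo : ((2 : ℕ) : ℚ) ^ K ≤ v := Int.zpow_log_le_self (by norm_num) hpos
        have hvhi : v < ((2 : ℕ) : ℚ) ^ (K + 1) := Int.lt_zpow_succ_log_self (by norm_num) v
        push_cast at hvlo hvhi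
        -- children's GOOD active lines (the μ-line when the child computes 0)
        have pick : ∀ (c : SumTree), GoodActiveTree q c → IsFloat q emin (eval fl c) →
            (0 < eval fl c → ∃ l ∈ allLines (unitRoundoff q) c,
              exact c - eval fl c ≤ (2 : ℚ) ^ (Int.log 2 (eval fl c)) * (l.1 - l.2) + l.2 * eval fl c) →
            ∃ l ∈ allLines (unitRoundoff q) c, l.2 ≤ l.1 ∧ (0 < eval fl c →
              exact c - eval fl c ≤ (2 : ℚ) ^ (Int.log 2 (eval fl c)) * (l.1 - l.2) + l.2 * eval fl c) := by
          intro c hGc hcF ih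
          by_cases hc : 0 < eval fl c
          · obtain ⟨l, hl, hbd⟩ := ih hc
            obtain ⟨l', hl', hg, hbd'⟩ := good_line_of_line hq hGc hcF hc hl hbd
            exact ⟨l', hl', hg, fun _ => hbd'⟩
          · refine ⟨_, mu_mem_allLines hu0 hu1 c, ?_, fun h' => absurd h' hc⟩
            have := one_le_treeM hu0 c; simp only; linarith
        obtain ⟨la, hla_mem, hga, hda⟩ := pick a (hG a hCa) haF iha
        obtain ⟨lb, hlb_mem, hgb, hdb⟩ := pick b (hG b hCb) hbF ihb
        obtain ⟨hLa, hMaLa, hAa0, hMaAa⟩ := allLines_bounds hu0 hu1 a la hla_mem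
        obtain ⟨hLb, hMbLb, hAb0, hMbAb⟩ := allLines_bounds hu0 hu1 b lb hlb_mem
        have hcov := nodeU_covers hq hfl (da := exact a - eval fl a) (db := exact b - eval fl b)
          haF hbF ha0 hb0 hLa hga hMaAa hLb hgb hMbAb
          (fun h0 => by linarith [iha0 h0]) (fun h0 => by have := hda h0; linarith)
          (fun h0 => by linarith [ihb0 h0]) (fun h0 => by have := hdb h0; linarith)
          (by rw [← hvdef]; exact hvlo) (by rw [← hvdef]; exact hvhi)
        rw [← hvdef] at hcov
        have hex : exact (.node a b) - v
            = (exact a - eval fl a) + (exact b - eval fl b) + (eval fl a + eval fl b - v) := by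
          simp only [exact]; ring
        rw [hex]
        refine hcov.elim (fun hT => ?_) (fun hT => ?_) (fun hT => ?_) (fun hT => ?_)
          (fun hT => ?_) (fun hT => ?_) (fun hT => ?_) (fun hT => ?_)
        · exact ⟨_, mem_allLines_F1 (b := b) hla_mem, by dsimp only; linarith⟩
        · exact ⟨_, mem_allLines_F1 (b := b) (mu_mem_allLines hu0 hu1 a), by dsimp only; linarith⟩
        · exact ⟨_, mem_allLines_F2 (a := a) hlb_mem, by dsimp only; linarith⟩
        · exact ⟨_, mem_allLines_F2 (a := a) (mu_mem_allLines hu0 hu1 b), by dsimp only; linarith⟩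
        · exact ⟨_, mem_allLines_F3 (a := a) hlb_mem, by dsimp only; linarith⟩
        · exact ⟨_, mem_allLines_F3 (a := a) (mu_mem_allLines hu0 hu1 b), by dsimp only; linarith⟩
        · exact ⟨_, mem_allLines_F4 (b := b) hla_mem, by dsimp only; linarith⟩
        · exact ⟨_, mem_allLines_F4 (b := b) (mu_mem_allLines hu0 hu1 a), by dsimp only; linarith⟩

/-- **CONJECTURE D FROM GOOD-ACTIVE.**  `p, q ≥ 1`, any nearest roundings `fl_q` into `F(q, emin)`
and `fl_p` into `F(p, emin)`; `C` a class of trees closed under children on which GOOD-ACTIVE holds.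
Every tree `t ∈ C` with nonnegative `F(q, emin)` data, evaluated in `F_q` and demoted once to `F_p`,
satisfies `s ≤ Q_t · fl_p(ŝ)` — NO hypothesis on `M_t`. -/
theorem exact_le_treeQf_mul_fl_of_goodActive {p : ℕ} (hp : 1 ≤ p) (hq : 1 ≤ q) {flp : ℚ → ℚ}
    (hfl : IsRoundNearest q emin fl) (hflp : IsRoundNearest p emin flp)
    (C : SumTree → Prop) (hC : ∀ a b, C (.node a b) → C a ∧ C b)
    (hG : ∀ s, C s → GoodActiveTree q s) (t : SumTree) (hCt : C t)
    (ht : ∀ x ∈ leaves t, IsFloat q emin x ∧ 0 ≤ x) :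
    exact t ≤ treeQf (unitRoundoff q) t (unitRoundoff p) * flp (eval fl t) := by
  obtain ⟨hzero, hline⟩ := deficit_allLine_bound hq hfl C hC hG t hCt ht
  exact exact_le_treeQf_mul_fl_of_invariant hp hfl hflp t ht hzero hline

/-- **GLOBAL FORM**: `GoodActive q` (part 6a) implies Conjecture D — `s ≤ Q_t · fl_p(ŝ)` — for EVERY
summation tree at precision `q`, every `p ≥ 1`, any nearest roundings, nonnegative `F(q, emin)` data.
CAVEAT (part 6e): `GoodActive 5` is false (and `GoodActive 4`), so at such precisions this form is
vacuous; use the class form `exact_le_treeQf_mul_fl_of_goodActive`. -/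
theorem conjectureD_of_goodActive (hGA : GoodActive q) {p : ℕ} (hp : 1 ≤ p) (hq : 1 ≤ q)
    {flp : ℚ → ℚ} (hfl : IsRoundNearest q emin fl) (hflp : IsRoundNearest p emin flp)
    (t : SumTree) (ht : ∀ x ∈ leaves t, IsFloat q emin x ∧ 0 ≤ x) :
    exact t ≤ treeQf (unitRoundoff q) t (unitRoundoff p) * flp (eval fl t) :=
  exact_le_treeQf_mul_fl_of_goodActive hp hq hfl hflp (fun _ => True) (fun _ _ _ => ⟨trivial, trivial⟩)
    (fun s _ => (goodActive_iff q).mp hGA s) t trivial ht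

end Main

/-! ## An unconditional class beyond `M_t ≤ 2`: u-balanced trees -/

/-- `t` is u-BALANCED: at every internal node the children's tree polynomials differ by at most `u`
(e.g. every perfect tree; every node whose two children have the same shape). -/
def UBalanced (u : ℚ) : SumTree → Prop
  | .leaf _ => True
  | .node a b => |treeM u a - treeM u b| ≤ u ∧ UBalanced u a ∧ UBalanced u b

/-- In a u-balanced tree EVERY line of the full family is good (`λ ≤ α`): the straight transforms
preserve goodness, and a transposed line `(u + μ_a + uλ, α)` of a line of `b` has
`α ≤ μ_b ≤ μ_a + u`. -/
theorem allLines_good_of_uBalanced {u : ℚ} (hu0 : 0 ≤ u) (hu1 : u ≤ 1) :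
    ∀ t : SumTree, UBalanced u t → ∀ l ∈ allLines u t, l.2 ≤ l.1
  | .leaf x, _, l, hl => by simp at hl; subst hl; simp
  | .node a b, ⟨hab, ha, hb⟩, l, hl => by
      have hab' := abs_le.mp hab
      rcases mem_allLines_node hl with ⟨m, hm, rfl⟩ | ⟨m, hm, rfl⟩ | ⟨m, hm, rfl⟩ | ⟨m, hm, rfl⟩
      · have := allLines_good_of_uBalanced hu0 hu1 a ha m hm
        have hMb := one_le_treeM hu0 b
        dsimp only; nlinarith [mul_nonneg hu0 (by linarith : (0:ℚ) ≤ treeM u b - 1)]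
      · have := allLines_good_of_uBalanced hu0 hu1 b hb m hm
        have hMa := one_le_treeM hu0 a
        dsimp only; nlinarith [mul_nonneg hu0 (by linarith : (0:ℚ) ≤ treeM u a - 1)]
      · obtain ⟨h0, -, -, h3⟩ := allLines_bounds hu0 hu1 b m hm
        dsimp only; nlinarith [mul_nonneg hu0 h0]
      · obtain ⟨h0, -, -, h3⟩ := allLines_bounds hu0 hu1 a m hm
        dsimp only; nlinarith [mul_nonneg hu0 h0]

/-- Hence GOOD-ACTIVE holds (at every excess, trivially) for u-balanced trees. -/
theorem goodActiveTree_of_uBalanced {q : ℕ} {t : SumTree} (ht : UBalanced (unitRoundoff q) t) :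
    GoodActiveTree q t :=
  fun _ _ l hl => ⟨l, hl, allLines_good_of_uBalanced (unitRoundoff_nonneg q) (unitRoundoff_le_one q)
    t ht l hl, le_rfl⟩

/-- **CONJECTURE D FOR u-BALANCED TREES (unconditional).**  `p, q ≥ 1`, any nearest roundings:
every u_q-balanced summation tree of nonnegative `F(q, emin)` data — in particular every perfect
(pairwise, `2^h` leaves) tree of ANY height — satisfies `s ≤ Q_t · fl_p(ŝ)`.  Part 5f covered
perfect trees only while `(1 + u_q)^h ≤ 2`. -/
theorem exact_le_treeQf_mul_fl_of_uBalanced {p q : ℕ} (hp : 1 ≤ p) (hq : 1 ≤ q) {emin : ℤ}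
    {fl flp : ℚ → ℚ} (hfl : IsRoundNearest q emin fl) (hflp : IsRoundNearest p emin flp)
    (t : SumTree) (hbal : UBalanced (unitRoundoff q) t)
    (ht : ∀ x ∈ leaves t, IsFloat q emin x ∧ 0 ≤ x) :
    exact t ≤ treeQf (unitRoundoff q) t (unitRoundoff p) * flp (eval fl t) :=
  exact_le_treeQf_mul_fl_of_goodActive hp hq hfl hflp (UBalanced (unitRoundoff q))
    (fun _ _ h => ⟨h.2.1, h.2.2⟩) (fun _ hs => goodActiveTree_of_uBalanced hs) t hbal ht

/-- Perfect trees: `IsPerfect t h` — every leaf at depth `h`. -/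
def IsPerfect : SumTree → ℕ → Prop
  | .leaf _, h => h = 0
  | .node a b, h => ∃ h', h = h' + 1 ∧ IsPerfect a h' ∧ IsPerfect b h'

/-- The tree polynomial of a perfect tree of height `h` is `(1+u)^h` (`u ≥ 0`). -/
theorem treeM_of_isPerfect {u : ℚ} (hu0 : 0 ≤ u) :
    ∀ (t : SumTree) (h : ℕ), IsPerfect t h → treeM u t = (1 + u) ^ h
  | .leaf x, h, hp => by simp [IsPerfect] at hp; subst hp; simp
  | .node a b, h, hp => by
      obtain ⟨h', rfl, ha, hb⟩ := hp
      rw [treeM_node, treeM_of_isPerfect hu0 a h' ha, treeM_of_isPerfect hu0 b h' hb, max_self, min_self,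
        pow_succ]
      ring

/-- Perfect trees are u-balanced (`u ≥ 0`). -/
theorem uBalanced_of_isPerfect {u : ℚ} (hu0 : 0 ≤ u) :
    ∀ (t : SumTree) (h : ℕ), IsPerfect t h → UBalanced u t
  | .leaf x, _, _ => trivial
  | .node a b, h, hp => by
      obtain ⟨h', rfl, ha, hb⟩ := hp
      refine ⟨?_, uBalanced_of_isPerfect hu0 a h' ha, uBalanced_of_isPerfect hu0 b h' hb⟩
      rw [treeM_of_isPerfect hu0 a h' ha, treeM_of_isPerfect hu0 b h' hb, sub_self, abs_zero]
      exact hu0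

/-- **Conjecture D for every PERFECT tree of every height** (pairwise summation of `2^h` nonnegative
`F_q` numbers, demoted once): `s ≤ Q_t · fl_p(ŝ)`, all `p, q ≥ 1`, any nearest roundings. -/
theorem exact_le_treeQf_mul_fl_of_isPerfect {p q : ℕ} (hp : 1 ≤ p) (hq : 1 ≤ q) {emin : ℤ}
    {fl flp : ℚ → ℚ} (hfl : IsRoundNearest q emin fl) (hflp : IsRoundNearest p emin flp)
    (t : SumTree) {h : ℕ} (hperf : IsPerfect t h)
    (ht : ∀ x ∈ leaves t, IsFloat q emin x ∧ 0 ≤ x) :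
    exact t ≤ treeQf (unitRoundoff q) t (unitRoundoff p) * flp (eval fl t) :=
  exact_le_treeQf_mul_fl_of_uBalanced hp hq hfl hflp t
    (uBalanced_of_isPerfect (unitRoundoff_nonneg q) t h hperf) ht

/-! ## Statement-style record (R4, CM-B / demote) -/

/-- R4 (Opt, CM-B demotion, OPTIMA T8(b)(iii) from GOOD-ACTIVE, class form): for all `p, q ≥ 1`,
every nearest rounding `fl_q` into `F(q, emin)` and `fl_p` into `F(p, emin)`, every class `C` of trees
closed under children on which GOOD-ACTIVE holds at precision `q`, and every tree `t ∈ C` with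
nonnegative data in `F(q, emin)`: `s ≤ Q_t · fl_p(ŝ)`, `Q_t = treeQf u_q t u_p` — no hypothesis on
the tree polynomial. -/
def R4_DemotionLawGoodActiveClass : Prop :=
  ∀ (p q : ℕ) (emin : ℤ) (flq flp : ℚ → ℚ), 1 ≤ p → 1 ≤ q →
    IsRoundNearest q emin flq → IsRoundNearest p emin flp →
    ∀ C : SumTree → Prop, (∀ a b, C (.node a b) → C a ∧ C b) → (∀ s, C s → GoodActiveTree q s) →
    ∀ t : SumTree, C t → (∀ x ∈ leaves t, IsFloat q emin x ∧ 0 ≤ x) →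
      exact t ≤ treeQf (unitRoundoff q) t (unitRoundoff p) * flp (eval flq t)

/-- Discharge of `R4_DemotionLawGoodActiveClass` by `exact_le_treeQf_mul_fl_of_goodActive`. -/
theorem R4_DemotionLawGoodActiveClass_holds : R4_DemotionLawGoodActiveClass :=
  fun _ _ _ _ _ hp hq hflq hflp C hC hG t hCt ht =>
    exact_le_treeQf_mul_fl_of_goodActive hp hq hflq hflp C hC hG t hCt ht

/-- R4 (Opt, CM-B demotion, unconditional): Conjecture D for every u_q-balanced tree (every perfect
tree of every height in particular), all `p, q ≥ 1`, any nearest roundings. -/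
def R4_DemotionLawUBalanced : Prop :=
  ∀ (p q : ℕ) (emin : ℤ) (flq flp : ℚ → ℚ), 1 ≤ p → 1 ≤ q →
    IsRoundNearest q emin flq → IsRoundNearest p emin flp →
    ∀ t : SumTree, UBalanced (unitRoundoff q) t → (∀ x ∈ leaves t, IsFloat q emin x ∧ 0 ≤ x) →
      exact t ≤ treeQf (unitRoundoff q) t (unitRoundoff p) * flp (eval flq t)

/-- Discharge of `R4_DemotionLawUBalanced`. -/
theorem R4_DemotionLawUBalanced_holds : R4_DemotionLawUBalanced :=
  fun _ _ _ _ _ hp hq hflq hflp t hb ht => exact_le_treeQf_mul_fl_of_uBalanced hp hq hflq hflp t hb ht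

end Summit.Ventures.CertifiedArithmetic.LowPrec.Opt
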